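import Summits.MatrixMultiplication.OmegaCensus.STPPVosperSlackOneA2CoverRowsN

/-!
# ω-census (abelian STPP census): case-α₂ cover rows for `{(2,3,3),(2,3,4),(3,3,2)} ⊆ ℤ₅₉` (kernel computation)

HONEST FRAMING (pub-omega census; verbatim): lottery ticket; floor = certified bounds/negative ranges.
Census STRUCTURE (seat pub-omega-stpp-1 gen 31, 2026-08-28), family (b2).  Rows of `a2CoverRowN` (duplicate pre-test form) for the pattern
`{(2,3,3),(2,3,4),(3,3,2)}` at `59`, reading `(a,b,c) = (2,4,3)` at the `(2,3,4)` block of the family `(−A, −C, −B)` (`z = L = 15`, `m = 16`,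
`n + 1 = 41`, `b = 4`, other blocks `(2,3,3), (3,2,3)`), two chunks (one `decide +kernel` each, ≈ 1 s per row; no duplicate-free configuration reaches
the cover search); assembled in `STPPVosperSlackOneCoverKillsZ59.lean`.  Pure finite computation; nothing here is progress on `ω`.
Python mirror: HOME `pub-omega-stpp-1-g31/code/pilot_beta_233_234_332.py`, `cover_mirror_z.py`.
-/

open Finset

namespace Summit.MatrixMultiplication.OmegaCensus.CubeNB

set_option maxHeartbeats 4000000 in
/-- Rows `0 ≤ j < 30` of `a2CoverRowN 59 41 15 4 {0, ±1, ±2, ±3} 15 [(2,3,3),(3,2,3)]`. [folklore] -/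
theorem a2CoverRowN_59_233234332_rows_0_30 :
    ((List.range' 0 30).all (a2CoverRowN 59 41 15 4 {0, 1, 58, 2, 57, 3, 56} 15 [(2, 3, 3), (3, 2, 3)])) = true := by
  decide +kernel

set_option maxHeartbeats 4000000 in
/-- Rows `30 ≤ j < 59` of `a2CoverRowN 59 41 15 4 {0, ±1, ±2, ±3} 15 [(2,3,3),(3,2,3)]`. [folklore] -/
theorem a2CoverRowN_59_233234332_rows_30_59 :
    ((List.range' 30 29).all (a2CoverRowN 59 41 15 4 {0, 1, 58, 2, 57, 3, 56} 15 [(2, 3, 3), (3, 2, 3)])) = true := by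
  decide +kernel

/-- **All rows of the case-α₂ cover table for `{(2,3,3),(2,3,4),(3,3,2)} ⊆ ℤ₅₉`.** [folklore] -/
theorem a2CoverRowN_59_233234332_all : ∀ j < 59, a2CoverRowN 59 41 15 4 {0, 1, 58, 2, 57, 3, 56} 15 [(2, 3, 3), (3, 2, 3)] j = true := by
  intro j hj
  by_cases h0 : j < 30
  · exact List.all_eq_true.1 a2CoverRowN_59_233234332_rows_0_30 j (List.mem_range'_1.2 ⟨by omega, by omega⟩)
  · exact List.all_eq_true.1 a2CoverRowN_59_233234332_rows_30_59 j (List.mem_range'_1.2 ⟨by omega, by omega⟩)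

end Summit.MatrixMultiplication.OmegaCensus.CubeNB
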